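import Summits.Langlands.Langlands.Theorems.IrreducibilityBySelfDualityRegularTwistCM
import Summits.Langlands.Langlands.Theorems.IrreducibilityBySelfDualityRegularTwistCMPairingCore
import Summits.Langlands.Langlands.Theorems.IrreducibilityBySelfDualityRegularTwistCMComplexFactorCasimir
import Summits.Langlands.Langlands.Theorems.IrreducibilityBySelfDualityRegularTwistCMCompactPlaceIntegrality
import Summits.Langlands.Langlands.Theorems.IrreducibilityBySelfDualityRegularTwistCMInfinityTypeOfLocalPairing
import Summits.Langlands.Langlands.Theorems.IrreducibilityBySelfDualityRegularTwistCMLocalPairingTransfer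
import Literature.NumberTheory.Automorphic.AutomorphicRepInfinitesimalCharacter
import HarnessLib

/-!
# Glue item `RegularTwistFromArchimedean` (route `IrreducibilityBySelfDuality`, item stmt-Langlands-15018)

The item: `GelbartJacquetLiftArchimedean → RegularTwistCM` — the promoted printed input
`GelbartJacquetLiftArchimedean` (item stmt-Langlands-15002; verbatim the named fact
`Literature.NumberTheory.Automorphic.GelbartJacquet_adjoint_lift_archimedean`, Gelbart–Jacquet 1978,
Thm. (9.3) with its archimedean clause Prop. (3.2)) FEEDS the crux `RegularTwistCM` (item
stmt-Langlands-14069): for `K` CM, `π` regular algebraic cuspidal on `GL₃(𝔸_K)`, `σ₀` cuspidal on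
`GL₂(𝔸_K)` and `ν` on `GL₁` with `t_π = d · Ad(t_{σ₀})` a.e., some `GL(1)`-twist of `σ₀` is regular
algebraic.

Status of the inputs. The crux body is landed modulo three archimedean named facts
(`RegularTwistCM.regularTwistCM_of_facts`, Theses-free), of which the third, the integral pairing
`AutomorphicRepData.exists_hasInfinityType` for `GL₂` data, is now a theorem of the tree (the five landed
stubs C1–C4, T of the crux lead's line `petersson-hermitian-purity` composed with
`AutomorphicRepData.exists_hasArchParameter_gl`, as in `RegularTwistCM.exists_hasInfinityType_gl_two`);
there remain the Gelbart–Jacquet fact — the antecedent of this item — and strong multiplicity one for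
`GL₃` at spherical level
(`strong_multiplicity_one_gl_sphericalLevel 3 K` for every number field `K`; Jacquet–Shalika 1981 II,
Thm. 4.4, with multiplicity one), consumed only through its archimedean consequence
`CuspidalAutomorphicRepData.hasArchParameter_eq_of_isNearlyEquivalent_of_smo` (nearly equivalent
cuspidal data on `GL₃` have the same Harish-Chandra parameter). Hence this item is, today, EXACTLY
strong multiplicity one for `GL₃`: `RegularTwistFromArchimedean_proof` proves it CONDITIONALLY on that
one named fact (statement structural — the antecedent by the name of the Literature fact, `rfl`-equal to
the route's `GelbartJacquetLiftArchimedean`; the consequent the body of `RegularTwistCM` verbatim — so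
that this module stays free of the route file: cycle hazard).
-/

set_option linter.dupNamespace false -- project-wide option; `Summit.Langlands.Langlands` is the mandated namespace

noncomputable section

open NumberField Filter
open Literature.NumberTheory.Automorphic

namespace Summit.Langlands.Langlands.Theorems.RegularTwistFromArchimedean

/-- **`RegularTwistFromArchimedean`** (item stmt-Langlands-15018: `GelbartJacquetLiftArchimedean →
RegularTwistCM`), CONDITIONAL on the printed input strong multiplicity one for `GL₃` at spherical level
(`strong_multiplicity_one_gl_sphericalLevel 3 K` for every number field `K`; Jacquet–Shalika 1981 II,
Thm. 4.4). Granted Gelbart–Jacquet's adjoint lift with its archimedean clause, for `K` CM, `π` regular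
algebraic cuspidal on `GL₃(𝔸_K)`, `σ₀` cuspidal on `GL₂(𝔸_K)` and a `GL(1)` datum `ν` with
`t_π = d · Ad(t_{σ₀})` a.e., some `GL(1)`-twist `σ = σ₀ ⊗ χ` is regular algebraic: the landed crux body
`RegularTwistCM.regularTwistCM_of_facts` (Gelbart–Jacquet lift `P` of `σ₀`, `π ≈ P ⊗ ν` nearly
equivalent, equal archimedean parameters by strong multiplicity one, integrality/regularity/purity of
`π` read on `Ad`, half-integral re-twisting over the CM field), its third input — an infinity type for the
`GL₂` datum `σ₀` — supplied by the landed stubs of the crux line: an archimedean parameter exists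
(`exists_hasArchParameter_gl`) and pairs integrally at each complex place (`stub_localPairingTransfer` fed
with `stub_pairingCore`, `stub_complexFactorCasimir`, `stub_compactPlaceIntegrality`), whence a well-formed
infinity type (`stub_infinityTypeOfLocalPairing`), exactly as in `RegularTwistCM.exists_hasInfinityType_gl_two`. The antecedent is the Literature fact by
name (`rfl`-equal to the route's `GelbartJacquetLiftArchimedean`), the consequent the body of the route's
`RegularTwistCM` verbatim. [cite: GelbartJacquet1978, Thm. (9.3), Prop. (3.2)]
[cite: JacquetShalikaAJM1981II, Thm. 4.4] [cite: Clozel1990, §3.3 and Lemme 4.9] -/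
theorem RegularTwistFromArchimedean_proof
    (hsmo : ∀ (K : Type) [Field K] [NumberField K],
      Literature.NumberTheory.Automorphic.strong_multiplicity_one_gl_sphericalLevel 3 K) :
    Literature.NumberTheory.Automorphic.GelbartJacquet_adjoint_lift_archimedean →
    ∀ (K : Type) [Field K] [NumberField K], NumberField.IsCMField K →
      ∀ (h1 : Literature.NumberTheory.Automorphic.isCompact_glFiniteIntegralLevel 1 K)
        (hcpt₂ : Literature.NumberTheory.Automorphic.isCompact_glFiniteIntegralLevel 2 K)
        (hcpt : Literature.NumberTheory.Automorphic.isCompact_glFiniteIntegralLevel 3 K)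
        (π : Literature.NumberTheory.Automorphic.CuspidalAutomorphicRepData 3 K hcpt)
        (σ₀ : Literature.NumberTheory.Automorphic.CuspidalAutomorphicRepData 2 K hcpt₂)
        (ν : Literature.NumberTheory.Automorphic.CuspidalAutomorphicRepData 1 K h1),
        π.1.IsRegularAlgebraic →
        (∀ᶠ v in cofinite, ∀ α β : Multiset ℂ, π.1.HasSatakeParamAt v α →
          σ₀.1.HasSatakeParamAt v β → ∃ d : ℂ, ν.1.HasSatakeParamAt v {d} ∧
            α = (((β ×ˢ β).map (fun p : ℂ × ℂ => p.1 * p.2⁻¹)).erase 1).map (fun c => d * c)) →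
        ∃ (σ : Literature.NumberTheory.Automorphic.CuspidalAutomorphicRepData 2 K hcpt₂)
          (χ : Literature.NumberTheory.Automorphic.CuspidalAutomorphicRepData 1 K h1),
          σ.1.IsRegularAlgebraic ∧ ∀ᶠ v in cofinite, ∀ β : Multiset ℂ, σ₀.1.HasSatakeParamAt v β →
            ∃ c : ℂ, χ.1.HasSatakeParamAt v {c} ∧ σ.1.HasSatakeParamAt v (β.map (fun b => c * b)) :=
  fun hGJ => RegularTwistCM.regularTwistCM_of_facts hGJ hsmo fun _K _ _ _hcpt₂ σ₀ => by
    obtain ⟨χ, hχ⟩ := σ₀.1.exists_hasArchParameter_gl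
    exact RegularTwistCM.stub_infinityTypeOfLocalPairing σ₀.1 χ hχ fun w =>
      RegularTwistCM.stub_localPairingTransfer
        (fun L R hLR s₁ s₂ t₁ t₂ hZL hCL hZR hCR hfin hint =>
          RegularTwistCM.stub_pairingCore L R hLR s₁ s₂ t₁ t₂ hZL hCL hZR hCR hfin hint)
        (fun ρ χ' hχ' => RegularTwistCM.stub_complexFactorCasimir ρ χ' hχ')
        (fun π' _ hρ' w' => RegularTwistCM.stub_compactPlaceIntegrality π' hρ' w') σ₀.1 χ hχ w

end Summit.Langlands.Langlands.Theorems.RegularTwistFromArchimedean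

end
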